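import Summits.BirchSwinnertonDyer.BirchSwinnertonDyer.Theorems.AlignedTransportAtTwoMainConjectureTransportAlignedAtTwoDeltaPosFunctionalDepleted
import Literature.NumberTheory.EllipticCurves.AlgebraicModularParametrizationWithShift
import HarnessLib

/-!
# Crux C1 `MainConjectureTransportAlignedAtTwo` (stmt-BirchSwinnertonDyer-22296), line `birth`, plan «deltapos-galois» step (G4), the T1⁺ INTERFACE:
# THE DEPLETED MODULAR PARAMETRISATION ON THE JACOBIAN `J₀(L)(ℂ) → W(ℂ)`, `[y] ↦ u_W(c·D_S·y(g))`, EXISTS AS AN ADDITIVE MAP, and its Galois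
# equivariance in REPRESENTATIVE FORM (the statement -ty is asked to type) yields the abstract `hgal` hypothesis of att-p3 g14's
# `…DeltaPosJacobianLevel.half_transport_link` (width seat att-p4 g13; `--supports 22296`)

THEOREMS ONLY (no `def`, no `sorry`, no named fact). BSD is not proved by this; C1 is not closed by this.

Context (memo `Cruxes/MainConjectureTransportAlignedAtTwo/DELTA-POS-ENGINE-att-p4-g13.md` §3(b), §4). For unequal conductors the Galois step runs at the
depleted level `L` (`N·D_S ∣ L`, `D_S = ∏_{ℓ∈S} ℓ²`) with the map `Φ : J₀(L)(ℂ) = V/Λ_L → W(ℂ)`, `[y] ↦ u_W(c·D_S·y(g))` (`g` the `S`-depleted form of the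
datum's newform `D.f`); att-p3's `half_transport_link` takes `Φ` as an ABSTRACT additive map pinned on half-classes and an ABSTRACT action
`gal σ : J0.tors L →+ J0.tors L` with a `jacobiMap_galAct`-shaped equivariance `hgal`. This file supplies the instantiation:

* `exists_depletedJacobiMap` (§1): `∃ Φ : J0 L →+ W(ℂ), ∀ y, Φ [y] = u_W(c·D_S·y(g))` — well defined on `V/Λ_L` because `c·D_S·y(g) ∈ Λ_E` for
  `y ∈ Λ_L` (`…DeltaPosFunctionalDepleted.maninConstant_mul_prodSq_mul_eval_depleted_mem`, Atkin–Lehner + `cΛ_f ⊆ Λ_E`); `depletedJacobiMap_half`: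
  the half-class form `Φ [x/2] = u_W(c·D_S·x(g)/2)` (att-p3's `hΦ`).
* `galAct_apply_of_repr` (§2): with a carrier `J' : ModularJacobianGaloisData L ι` (T1 at level `L`) and the T1⁺ statement in REPRESENTATIVE form —
  «if `σ[y] = [y']` in `J₀(L)(ℚ̄)_tors` and `u_W(c·D_S·y(g)) = ι P` then `u_W(c·D_S·y'(g)) = ι (σP)`» (hypothesis `hT1`; PRINT: the depleted
  parametrisation `Σ_d c_d (D_S/d)·φ_D ∘ π_{d*}` is defined over `ℚ`, DDT 1995 §1.5/§1.7) — the abstract `hgal` holds for `Φ` and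
  `gal σ := (J'.galAct σ)` read as an additive map.

References: Darmon–Diamond–Taylor 1995 §1.5, §1.7 [DarmonDiamondTaylor1995]; Atkin–Lehner 1970 §3 [AtkinLehner1970]; Cremona 1997 §2.10 [CremonaAlgorithms1997].
-/

noncomputable section

-- justification: the `Summit.BirchSwinnertonDyer.BirchSwinnertonDyer.…` path repeats a component (route-file convention)
set_option linter.dupNamespace false
set_option autoImplicit false

open scoped ModularForm
open Complex CongruenceSubgroup
open Literature.NumberTheory.EllipticCurves Literature.NumberTheory.EllipticCurves.ModularForms
open Summit.BirchSwinnertonDyer.BirchSwinnertonDyer.Theorems.AlignedTransportAtTwoDeltaPosFunctionalDepleted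

namespace Summit.BirchSwinnertonDyer.BirchSwinnertonDyer.Theorems.AlignedTransportAtTwoDeltaPosJacobianLevelMap

variable {W : WeierstrassCurve ℚ} {N : ℕ} [NeZero N] (D : ModularParametrizationData W N)
  (S : Finset ℕ) (hS : ∀ ℓ ∈ S, ℓ.Prime) (L : ℕ) [NeZero L] (hNL : N * ∏ ℓ ∈ S, ℓ ^ 2 ∣ L)
  (g : CuspForm (Gamma0 L) 2) (hg : ∀ n : ℕ, cuspCoeff g n = if ∃ ℓ ∈ S, ℓ ∣ n then 0 else cuspCoeff D.f n)

/-! ## §1 The depleted parametrisation on `J₀(L)(ℂ)` exists as an additive map -/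

include hS hNL hg in
/-- **The depleted modular parametrisation on the Jacobian.** For a datum `D` of `W` (level `N`), a finite set `S` of primes, a level `L` with
`N·∏_{ℓ∈S}ℓ² ∣ L` and the `S`-depleted form `g` of `D.f` at level `L`: there is an additive map `Φ : J₀(L)(ℂ) = V/Λ_L → W(ℂ)` with
`Φ [y] = u_W(c·D_S·y(g))` for EVERY `y ∈ V` (`D_S = ∏ ℓ²`) — the lift of `y ↦ u_W(c·D_S·y(g))`, which kills `Λ_L` since `c·D_S·y(g) ∈ Λ_E` there.
[cite: DarmonDiamondTaylor1995, §1.7 Def. 1.44 and Lemma 1.46] [cite: AtkinLehner1970, §3] -/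
theorem exists_depletedJacobiMap :
    ∃ Φ : J0 L →+ (W.baseChange ℂ).toAffine.Point, ∀ y : Module.Dual ℂ (CuspForm (Gamma0 L) 2),
      Φ (Submodule.Quotient.mk y) = D.uniformize ((D.c : ℂ) * (((∏ ℓ ∈ S, ℓ ^ 2 : ℕ) : ℂ) * y g)) := by
  let ψ : Module.Dual ℂ (CuspForm (Gamma0 L) 2) →+ ℂ :=
    { toFun := fun y ↦ (D.c : ℂ) * (((∏ ℓ ∈ S, ℓ ^ 2 : ℕ) : ℂ) * y g)
      map_zero' := by simp
      map_add' := fun y y' ↦ by simp only [LinearMap.add_apply]; ring }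
  refine ⟨QuotientAddGroup.lift (periodHomologyHecke L).toAddSubgroup (D.uniformize.comp ψ) fun y hy ↦ ?_, fun y ↦ rfl⟩
  rw [AddMonoidHom.mem_ker, AddMonoidHom.comp_apply, D.uniformize_eq_zero_iff]
  exact maninConstant_mul_prodSq_mul_eval_depleted_mem D S hS L hNL g hg ((mem_periodHomologyHecke (N := L)).mp hy)

/-- **Half-class form** (att-p3's hypothesis `hΦ` of `…DeltaPosJacobianLevel.half_transport_link`): if `Φ [y] = u_W(c·D_S·y(g))` for all `y`, then
`Φ [x/2] = u_W(c·D_S·x(g)/2)`. [folklore] -/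
theorem depletedJacobiMap_half {Φ : J0 L →+ (W.baseChange ℂ).toAffine.Point}
    (hΦ : ∀ y : Module.Dual ℂ (CuspForm (Gamma0 L) 2),
      Φ (Submodule.Quotient.mk y) = D.uniformize ((D.c : ℂ) * (((∏ ℓ ∈ S, ℓ ^ 2 : ℕ) : ℂ) * y g)))
    (x : Module.Dual ℂ (CuspForm (Gamma0 L) 2)) :
    Φ (Submodule.Quotient.mk ((2 : ℂ)⁻¹ • x)) = D.uniformize ((D.c : ℂ) * (((∏ ℓ ∈ S, ℓ ^ 2 : ℕ) : ℂ) * x g) / 2) := by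
  rw [hΦ, LinearMap.smul_apply, smul_eq_mul]
  congr 1; ring

/-! ## §2 The T1⁺ statement in representative form yields the abstract equivariance `hgal` -/

/-- **T1⁺ (representative form) ⟹ `hgal`.** `J'` a `ℚ`-structure carrier of `J₀(L)` (T1 at level `L`); `Φ` the depleted parametrisation (§1). IF for every
`σ ∈ Γ_ℚ`, all representatives `y, y'` with `σ·[y] = [y']` on torsion and every `P ∈ W(ℚ̄)`, `u_W(c·D_S·y(g)) = ι P ⟹ u_W(c·D_S·y'(g)) = ι (σ P)`
(hypothesis `hT1` — the typing ask T1⁺: the depleted parametrisation is defined over `ℚ`), THEN `Φ` is equivariant for `gal σ := J'.galAct σ` in the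
shape of `ModularJacobianGaloisData.jacobiMap_galAct`. [cite: DarmonDiamondTaylor1995, §1.5 and §1.7] -/
theorem galAct_apply_of_repr (ι : AlgebraicClosure ℚ →+* ℂ) (J' : ModularJacobianGaloisData L ι)
    {Φ : J0 L →+ (W.baseChange ℂ).toAffine.Point}
    (hΦ : ∀ y : Module.Dual ℂ (CuspForm (Gamma0 L) 2),
      Φ (Submodule.Quotient.mk y) = D.uniformize ((D.c : ℂ) * (((∏ ℓ ∈ S, ℓ ^ 2 : ℕ) : ℂ) * y g)))
    (hT1 : ∀ (σ : Field.absoluteGaloisGroup ℚ) (y y' : Module.Dual ℂ (CuspForm (Gamma0 L) 2))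
      (hy : (Submodule.Quotient.mk y : J0 L) ∈ J0.tors L),
      ((J'.galAct σ ⟨Submodule.Quotient.mk y, hy⟩ : J0.tors L) : J0 L) = Submodule.Quotient.mk y' →
      ∀ P : W.geomPoints, D.uniformize ((D.c : ℂ) * (((∏ ℓ ∈ S, ℓ ^ 2 : ℕ) : ℂ) * y g)) = W.geomPointsToComplex ι P →
        D.uniformize ((D.c : ℂ) * (((∏ ℓ ∈ S, ℓ ^ 2 : ℕ) : ℂ) * y' g)) = W.geomPointsToComplex ι (σ • P))
    (σ : Field.absoluteGaloisGroup ℚ) (t : J0.tors L) (P : W.geomPoints)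
    (ht : Φ (t : J0 L) = W.geomPointsToComplex ι P) :
    Φ (((J'.galAct σ).toLinearMap.toAddMonoidHom t : J0.tors L) : J0 L) = W.geomPointsToComplex ι (σ • P) := by
  obtain ⟨y, hy⟩ := Submodule.Quotient.mk_surjective (periodHomologyHecke L) (t : J0 L)
  obtain ⟨y', hy'⟩ := Submodule.Quotient.mk_surjective (periodHomologyHecke L) ((J'.galAct σ t : J0.tors L) : J0 L)
  have hyt : (Submodule.Quotient.mk y : J0 L) ∈ J0.tors L := hy ▸ t.2
  have htt : t = ⟨Submodule.Quotient.mk y, hyt⟩ := Subtype.ext hy.symm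
  have hrepr : ((J'.galAct σ ⟨Submodule.Quotient.mk y, hyt⟩ : J0.tors L) : J0 L) = Submodule.Quotient.mk y' := by
    rw [← htt, hy']
  have hP : D.uniformize ((D.c : ℂ) * (((∏ ℓ ∈ S, ℓ ^ 2 : ℕ) : ℂ) * y g)) = W.geomPointsToComplex ι P := by
    rw [← hΦ, hy, ht]
  have key := hT1 σ y y' hyt hrepr P hP
  rw [LinearMap.toAddMonoidHom_coe, LinearEquiv.coe_coe, ← hy', hΦ]
  exact key

end Summit.BirchSwinnertonDyer.BirchSwinnertonDyer.Theorems.AlignedTransportAtTwoDeltaPosJacobianLevelMap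

end
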